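import Summits.BirchSwinnertonDyer.BirchSwinnertonDyer.Theses.CycTangentCM
import Literature.NumberTheory.EllipticCurves.DeShalit1987.KatzMeasureMonomialLinesPAdic
import Literature.NumberTheory.EllipticCurves.IntSeriesTwoPointCertificate
import HarnessLib

/-!
# Crux `CycTangentCM.CycTangentBound` (stmt-BirchSwinnertonDyer-22628), negative road: the RADIUS-FREE
# TWO-POINT KILL — three value norms on ONE line of the frame plus the cyclotomic segment `m ≤ 3`
# REFUTE `CycTangentBound` (`--supports 22628`; nothing is closed; BSD is not proved by any of this)

Seat `prover-bsd-line-ctcm-p3` g2 (D-0145 line `route-BirchSwinnertonDyer-CycTangentCM`, prover 3/3).  The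
N-line assembly of this seat's g0 (`not_cycTangentBound_of_fwdDiffCertificate`, p589997) certifies
`λ̄ = k` on a line from `k + 1` values through normalised forward differences and needs the EXACT radius
`‖u − 1‖` of the geometric nodes `uᵗ − 1` (plus a drift and `u ≠ 1`).  At the lead's witnesses of the
refutation of the crux (`(y² = x³ − 2, 7)`, `(27a ⊗ 17, 7)`: `m₀ ≤ 2` on the split-prime line against
`λ̄_cyc = 5`, `Cruxes/CycTangentBound/REFUTED.md`) the radius `‖u − 1‖ = 7⁻¹` is an ARITHMETIC input
(the image of inertia at `v` under the avatar of `ψ⁶` is all of `1 + 7ℤ₇`) that is not in the kernel.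
This file removes it: with the radius-free certificate
`Literature.NumberTheory.EllipticCurves.IntSeries.isUnit_coeff_two_of_nodeValues` (p591326) the exact
radius is a CONSEQUENCE of the three value norms, and only the free upper bound `‖u − 1‖ ≤ ‖ϖ‖`
(`ϖ = p`: automatic for a character with values in the one-units of level `|p|`) is assumed.

* `not_cycTangentBound_of_twoPointValues` — **THE TWO-POINT KILL (kernel form).**  In the frame of the
  crux (its binders verbatim, `G` with `IsKatzMeasure₂ … ψ⁻¹ … G`): a line direction `(c₁, c₂) ∈ ℤ_p²`,
  `ϖ, u ∈ ℂ_p` with `‖ϖ‖ < 1`, `‖u − 1‖ ≤ ‖ϖ‖`, values `x_t` of the branch `monomialLine c₁ c₂ G` at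
  `uᵗ − 1` (`t ≤ 2`) with `‖x₀‖ < ‖ϖ‖²`, `‖x₁‖ < ‖ϖ‖²`, `‖x₂‖ = ‖ϖ‖²`, and the cyclotomic segment
  `[T^m]G(0,T) ∈ 𝔪` for `m ≤ 3` — together give `¬ CycTangentBound`: the line has a unit coefficient in
  degree `2` (two-point certificate; `p ≠ 2` from `5 ≤ p`), hence `G` a unit coefficient `[T₁^iT₂^j]G`
  with `i + j ≤ 2` (`IntSeries.exists_isUnit_coeff_coeff_of_isUnit_coeff_monomialLine`), which CTB would
  turn into a unit `[T^m]G(0,T)` with `m ≤ 3`.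
* `not_cycTangentBound_of_onePointValues` — the one-step sibling: `‖x₀‖ < ‖ϖ‖`, `‖x₁‖ = ‖ϖ‖` and the
  segment `m ≤ 2` refute CTB (a witness with `m₀ ≤ 1` on a line against `λ̄_cyc ≥ 3`; none is claimed).
* `not_cycTangentBound_of_twoPointValues_unitPeriod` — the same with the values written as the frame
  delivers them, `x_t = a_t · Ω_p^{k_t}` with `‖Ω_p‖ = 1` (de Shalit's `Ω_p ∈ R₀ˣ`, as in
  `DeShalit1987.thmII417_exists_katzSheet`): the three norm conditions are then conditions on the
  `p`-adic numbers `a_t = ι⁻¹(interpolationValue …)` alone.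

What remains OUTSIDE this file: the supply of the values on a line (this seat's g0
`CycTangentCMCycTangentBoundSplitPrimePowerLine.exists_splitPrimeLine_powerLine`, or any explicit line),
the three norms (algebraic Hecke `L`-values: a numerical fact), the cyclotomic segment (the lead's
`forall_not_isUnit_coeff_constantCoeff_of_sec12`, p586224, from `λ_p(A) ≥ 4`), and the existence of the
frame.  Nothing here asserts that such data exist; crux 22628 is not closed here; BSD is not proved.
References: [deShalit1987] II.4.16–4.17; [Washington1997] §5.2; [Gouvea1993PadicNumbers] §5.6.
-/

set_option linter.dupNamespace false
set_option autoImplicit false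

noncomputable section

open Literature.NumberTheory.GaloisRepresentations
open Literature.NumberTheory.EllipticCurves

namespace Summit.BirchSwinnertonDyer.BirchSwinnertonDyer.Theorems

/-! ### §1. The two-point kill -/

/-- **TWO-POINT KILL (kernel form): three value norms on ONE line of the crux's frame, together with the
cyclotomic non-unit segment up to degree `3`, REFUTE `CycTangentBound`.**  In the frame of the crux
(binders verbatim; `G` the two-variable branch, `IsKatzMeasure₂ … ψ⁻¹ … G`): given a line direction
`(c₁, c₂)`, `ϖ, u ∈ ℂ_p` with `‖ϖ‖ < 1` and `‖u − 1‖ ≤ ‖ϖ‖`, values `x_t` of `monomialLine c₁ c₂ G` at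
`uᵗ − 1` (`t ≤ 2`) with `‖x₀‖ < ‖ϖ‖²`, `‖x₁‖ < ‖ϖ‖²`, `‖x₂‖ = ‖ϖ‖²`, and `[T^m]G(0,T) ∈ 𝔪` for all
`m ≤ 3`: then `¬ CycTangentBound`.  No drift, no `u ≠ 1`, no exact radius among the hypotheses (the
radius `‖u − 1‖ = ‖ϖ‖` follows).  Nothing asserts that such data exist. -/
theorem not_cycTangentBound_of_twoPointValues :
    ∀ (A : WeierstrassCurve ℚ) [A.IsElliptic] [A.IsGloballyMinimal] (p : ℕ) [Fact p.Prime], 5 ≤ p →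
      A.j ∈ Literature.NumberTheory.EllipticCurves.maximalCMJInvariants → A.HasGoodReductionAtPrime
      p → ¬ (p : ℤ) ∣ A.frobeniusTrace p → A.HasIrreducibleModPGaloisRep p → ∀ (K : Type) [Field K]
      [NumberField K], Literature.NumberTheory.EllipticCurves.IsCMFieldOfJ K A.j → ∀ (ψ :
      Literature.NumberTheory.GaloisRepresentations.HeckeCharacter K), ψ.HasInfinityType (fun _ ↦
      1) (fun _ ↦ 0) → (∀ s : ℂ, 3 / 2 < s.re →
      Literature.NumberTheory.GaloisRepresentations.heckeLFunction ψ s = A.LSeries s) → ∀ (ι :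
      PadicAlgCl p ≃+* ℂ) (v vbar : IsDedekindDomain.HeightOneSpectrum (NumberField.RingOfIntegers
      K)), ((p : ℕ) : NumberField.RingOfIntegers K) ∈ v.asIdeal → ((p : ℕ) :
      NumberField.RingOfIntegers K) ∈ vbar.asIdeal → vbar ≠ v → (∀ (w : NumberField.InfinitePlace
      K) (k : NumberField.RingOfIntegers K), k ∈ v.asIdeal ↔ ‖ι.symm (w.embedding (k : K))‖ < 1) →
      ∀ (S : Finset (IsDedekindDomain.HeightOneSpectrum (NumberField.RingOfIntegers K))), v ∉ S →
      vbar ∉ S → (∀ w ∈ S, ¬ ψ.IsUnramifiedAt w) → (∀ w : IsDedekindDomain.HeightOneSpectrum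
      (NumberField.RingOfIntegers K), w ∉ S → ψ.IsUnramifiedAt w) → ∀ (κ₁ κ₂ :
      Literature.NumberTheory.EllipticCurves.ZpExtension K p) (γ₁ γ₂ : Field.absoluteGaloisGroup
      K), Literature.NumberTheory.EllipticCurves.ZpExtension.IsTopGeneratorPair κ₁ κ₂ γ₁ γ₂ →
      κ₂.IsCyclotomic → (∃ ζ : (PadicInt p)ˣ, IsOfFinOrder ζ ∧
      ((Literature.NumberTheory.GaloisRepresentations.GaloisRep.cyclotomicCharacter K p γ₂ * ζ :
      (PadicInt p)ˣ) : PadicInt p) = (Literature.NumberTheory.EllipticCurves.cyclotomicGenerator p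
      : PadicInt p)) → ∀ (Ω δ : ℂ) (Ωp : PadicComplex p), Ω ≠ 0 → Ωp ≠ 0 → (δ ^ 2 =
      (NumberField.discr K : ℂ) ∨ δ ^ 2 = -(NumberField.discr K : ℂ)) → ∀ (G : PowerSeries
      (PowerSeries (PadicComplexInt p))), Literature.NumberTheory.EllipticCurves.IsKatzMeasure₂ ι v
      vbar S κ₁ κ₂ γ₁ γ₂ ψ⁻¹ Ω δ Ωp G →
      ∀ (c₁ c₂ : ℤ_[p]) (ϖ u : ℂ_[p]) (val : ℕ → ℂ_[p]), ‖ϖ‖ < 1 → ‖u - 1‖ ≤ ‖ϖ‖ →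
      (∀ t, t ≤ 2 → IntSeries.HasValueAt (IntSeries.monomialLine c₁ c₂ G) (u ^ t - 1) (val t)) →
      ‖val 0‖ < ‖ϖ‖ ^ 2 → ‖val 1‖ < ‖ϖ‖ ^ 2 → ‖val 2‖ = ‖ϖ‖ ^ 2 →
      (∀ m : ℕ, m ≤ 3 → ¬ IsUnit (PowerSeries.coeff m (PowerSeries.constantCoeff G))) →
      ¬ Summit.BirchSwinnertonDyer.BirchSwinnertonDyer.Theses.CycTangentCM.CycTangentBound := by
  intro A _ _ p _ hp hj hgood hord hirr K _ _ hK ψ hψ hL ι v vbar hv hvbar hne hι S hvS hvbarS hSram hSunr κ₁ κ₂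
    γ₁ γ₂ hpair hcyc hγ₂ Ω δ Ωp hΩ hΩp hδ G hG c₁ c₂ ϖ u val hϖ hu hval h0 h1 h2 hgap hC
  have hp2 : p ≠ 2 := by omega
  -- the line has a unit coefficient in degree `2` (radius-free two-point certificate) …
  have hunit : IsUnit (PowerSeries.coeff 2 (IntSeries.monomialLine c₁ c₂ G)) :=
    (IntSeries.isUnit_coeff_two_of_nodeValues hp2 _ hϖ hu hval h0 h1 h2).1
  -- … coming from a unit `[T₁^i T₂^j]G` with `i + j ≤ 2` …
  obtain ⟨i, j, hij, hunit'⟩ := IntSeries.exists_isUnit_coeff_coeff_of_isUnit_coeff_monomialLine hunit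
  -- … which `CycTangentBound` turns into a unit coefficient of `G(0,T)` in degree `≤ i + j + 1 ≤ 3`
  obtain ⟨m, hm, hmu⟩ := hC A p hp hj hgood hord hirr K hK ψ hψ hL ι v vbar hv hvbar hne hι S hvS hvbarS hSram
    hSunr κ₁ κ₂ γ₁ γ₂ hpair hcyc hγ₂ Ω δ Ωp hΩ hΩp hδ G hG i j hunit'
  exact hgap m (by omega) hmu

/-! ### §2. The one-point sibling -/

/-- **ONE-POINT KILL (kernel form)**: in the frame of the crux, a line direction `(c₁, c₂)`, `ϖ, u`
with `‖ϖ‖ < 1`, `‖u − 1‖ ≤ ‖ϖ‖`, values `x_t` of `monomialLine c₁ c₂ G` at `uᵗ − 1` (`t ≤ 1`) with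
`‖x₀‖ < ‖ϖ‖`, `‖x₁‖ = ‖ϖ‖`, and `[T^m]G(0,T) ∈ 𝔪` for `m ≤ 2` give `¬ CycTangentBound` (the line has
`λ̄ ≤ 1`, CTB would force `λ̄_cyc ≤ 2`).  Nothing asserts that such data exist. -/
theorem not_cycTangentBound_of_onePointValues :
    ∀ (A : WeierstrassCurve ℚ) [A.IsElliptic] [A.IsGloballyMinimal] (p : ℕ) [Fact p.Prime], 5 ≤ p →
      A.j ∈ Literature.NumberTheory.EllipticCurves.maximalCMJInvariants → A.HasGoodReductionAtPrime
      p → ¬ (p : ℤ) ∣ A.frobeniusTrace p → A.HasIrreducibleModPGaloisRep p → ∀ (K : Type) [Field K]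
      [NumberField K], Literature.NumberTheory.EllipticCurves.IsCMFieldOfJ K A.j → ∀ (ψ :
      Literature.NumberTheory.GaloisRepresentations.HeckeCharacter K), ψ.HasInfinityType (fun _ ↦
      1) (fun _ ↦ 0) → (∀ s : ℂ, 3 / 2 < s.re →
      Literature.NumberTheory.GaloisRepresentations.heckeLFunction ψ s = A.LSeries s) → ∀ (ι :
      PadicAlgCl p ≃+* ℂ) (v vbar : IsDedekindDomain.HeightOneSpectrum (NumberField.RingOfIntegers
      K)), ((p : ℕ) : NumberField.RingOfIntegers K) ∈ v.asIdeal → ((p : ℕ) :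
      NumberField.RingOfIntegers K) ∈ vbar.asIdeal → vbar ≠ v → (∀ (w : NumberField.InfinitePlace
      K) (k : NumberField.RingOfIntegers K), k ∈ v.asIdeal ↔ ‖ι.symm (w.embedding (k : K))‖ < 1) →
      ∀ (S : Finset (IsDedekindDomain.HeightOneSpectrum (NumberField.RingOfIntegers K))), v ∉ S →
      vbar ∉ S → (∀ w ∈ S, ¬ ψ.IsUnramifiedAt w) → (∀ w : IsDedekindDomain.HeightOneSpectrum
      (NumberField.RingOfIntegers K), w ∉ S → ψ.IsUnramifiedAt w) → ∀ (κ₁ κ₂ :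
      Literature.NumberTheory.EllipticCurves.ZpExtension K p) (γ₁ γ₂ : Field.absoluteGaloisGroup
      K), Literature.NumberTheory.EllipticCurves.ZpExtension.IsTopGeneratorPair κ₁ κ₂ γ₁ γ₂ →
      κ₂.IsCyclotomic → (∃ ζ : (PadicInt p)ˣ, IsOfFinOrder ζ ∧
      ((Literature.NumberTheory.GaloisRepresentations.GaloisRep.cyclotomicCharacter K p γ₂ * ζ :
      (PadicInt p)ˣ) : PadicInt p) = (Literature.NumberTheory.EllipticCurves.cyclotomicGenerator p
      : PadicInt p)) → ∀ (Ω δ : ℂ) (Ωp : PadicComplex p), Ω ≠ 0 → Ωp ≠ 0 → (δ ^ 2 =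
      (NumberField.discr K : ℂ) ∨ δ ^ 2 = -(NumberField.discr K : ℂ)) → ∀ (G : PowerSeries
      (PowerSeries (PadicComplexInt p))), Literature.NumberTheory.EllipticCurves.IsKatzMeasure₂ ι v
      vbar S κ₁ κ₂ γ₁ γ₂ ψ⁻¹ Ω δ Ωp G →
      ∀ (c₁ c₂ : ℤ_[p]) (ϖ u : ℂ_[p]) (val : ℕ → ℂ_[p]), ‖ϖ‖ < 1 → ‖u - 1‖ ≤ ‖ϖ‖ →
      (∀ t, t ≤ 1 → IntSeries.HasValueAt (IntSeries.monomialLine c₁ c₂ G) (u ^ t - 1) (val t)) →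
      ‖val 0‖ < ‖ϖ‖ → ‖val 1‖ = ‖ϖ‖ →
      (∀ m : ℕ, m ≤ 2 → ¬ IsUnit (PowerSeries.coeff m (PowerSeries.constantCoeff G))) →
      ¬ Summit.BirchSwinnertonDyer.BirchSwinnertonDyer.Theses.CycTangentCM.CycTangentBound := by
  intro A _ _ p _ hp hj hgood hord hirr K _ _ hK ψ hψ hL ι v vbar hv hvbar hne hι S hvS hvbarS hSram hSunr κ₁ κ₂
    γ₁ γ₂ hpair hcyc hγ₂ Ω δ Ωp hΩ hΩp hδ G hG c₁ c₂ ϖ u val hϖ hu hval h0 h1 hgap hC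
  have hunit : IsUnit (PowerSeries.coeff 1 (IntSeries.monomialLine c₁ c₂ G)) :=
    (IntSeries.isUnit_coeff_one_of_nodeValues _ hϖ hu hval h0 h1).1
  obtain ⟨i, j, hij, hunit'⟩ := IntSeries.exists_isUnit_coeff_coeff_of_isUnit_coeff_monomialLine hunit
  obtain ⟨m, hm, hmu⟩ := hC A p hp hj hgood hord hirr K hK ψ hψ hL ι v vbar hv hvbar hne hι S hvS hvbarS hSram
    hSunr κ₁ κ₂ γ₁ γ₂ hpair hcyc hγ₂ Ω δ Ωp hΩ hΩp hδ G hG i j hunit'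
  exact hgap m (by omega) hmu

/-! ### §3. Values as the frame delivers them: `x_t = a_t · Ω_p^{k_t}` with `‖Ω_p‖ = 1` -/

/-- The norm of `a · Ω_p^k` is the norm of `a` when `‖Ω_p‖ = 1`. -/
theorem norm_mul_pow_eq_of_norm_eq_one {p : ℕ} [Fact p.Prime] {Ωp : ℂ_[p]} (hΩp : ‖Ωp‖ = 1)
    (a : ℂ_[p]) (k : ℕ) : ‖a * Ωp ^ k‖ = ‖a‖ := by
  rw [norm_mul, norm_pow, hΩp, one_pow, mul_one]

/-- **TWO-POINT KILL with a unit `p`-adic period.**  As `not_cycTangentBound_of_twoPointValues`, with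
the values written `x_t = a_t · Ω'^{k_t}` for some `Ω' ∈ ℂ_p` with `‖Ω'‖ = 1` (the frame's
`x_t = ι⁻¹(interpolationValue …) · Ω_p^{k_t}`, `Ω_p ∈ R₀ˣ`): the three norm conditions are then
`‖a₀‖ < ‖ϖ‖²`, `‖a₁‖ < ‖ϖ‖²`, `‖a₂‖ = ‖ϖ‖²`.  Nothing asserts that such data exist. -/
theorem not_cycTangentBound_of_twoPointValues_unitPeriod :
    ∀ (A : WeierstrassCurve ℚ) [A.IsElliptic] [A.IsGloballyMinimal] (p : ℕ) [Fact p.Prime], 5 ≤ p →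
      A.j ∈ Literature.NumberTheory.EllipticCurves.maximalCMJInvariants → A.HasGoodReductionAtPrime
      p → ¬ (p : ℤ) ∣ A.frobeniusTrace p → A.HasIrreducibleModPGaloisRep p → ∀ (K : Type) [Field K]
      [NumberField K], Literature.NumberTheory.EllipticCurves.IsCMFieldOfJ K A.j → ∀ (ψ :
      Literature.NumberTheory.GaloisRepresentations.HeckeCharacter K), ψ.HasInfinityType (fun _ ↦
      1) (fun _ ↦ 0) → (∀ s : ℂ, 3 / 2 < s.re →
      Literature.NumberTheory.GaloisRepresentations.heckeLFunction ψ s = A.LSeries s) → ∀ (ι :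
      PadicAlgCl p ≃+* ℂ) (v vbar : IsDedekindDomain.HeightOneSpectrum (NumberField.RingOfIntegers
      K)), ((p : ℕ) : NumberField.RingOfIntegers K) ∈ v.asIdeal → ((p : ℕ) :
      NumberField.RingOfIntegers K) ∈ vbar.asIdeal → vbar ≠ v → (∀ (w : NumberField.InfinitePlace
      K) (k : NumberField.RingOfIntegers K), k ∈ v.asIdeal ↔ ‖ι.symm (w.embedding (k : K))‖ < 1) →
      ∀ (S : Finset (IsDedekindDomain.HeightOneSpectrum (NumberField.RingOfIntegers K))), v ∉ S →
      vbar ∉ S → (∀ w ∈ S, ¬ ψ.IsUnramifiedAt w) → (∀ w : IsDedekindDomain.HeightOneSpectrum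
      (NumberField.RingOfIntegers K), w ∉ S → ψ.IsUnramifiedAt w) → ∀ (κ₁ κ₂ :
      Literature.NumberTheory.EllipticCurves.ZpExtension K p) (γ₁ γ₂ : Field.absoluteGaloisGroup
      K), Literature.NumberTheory.EllipticCurves.ZpExtension.IsTopGeneratorPair κ₁ κ₂ γ₁ γ₂ →
      κ₂.IsCyclotomic → (∃ ζ : (PadicInt p)ˣ, IsOfFinOrder ζ ∧
      ((Literature.NumberTheory.GaloisRepresentations.GaloisRep.cyclotomicCharacter K p γ₂ * ζ :
      (PadicInt p)ˣ) : PadicInt p) = (Literature.NumberTheory.EllipticCurves.cyclotomicGenerator p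
      : PadicInt p)) → ∀ (Ω δ : ℂ) (Ωp : PadicComplex p), Ω ≠ 0 → Ωp ≠ 0 → (δ ^ 2 =
      (NumberField.discr K : ℂ) ∨ δ ^ 2 = -(NumberField.discr K : ℂ)) → ∀ (G : PowerSeries
      (PowerSeries (PadicComplexInt p))), Literature.NumberTheory.EllipticCurves.IsKatzMeasure₂ ι v
      vbar S κ₁ κ₂ γ₁ γ₂ ψ⁻¹ Ω δ Ωp G →
      ∀ (c₁ c₂ : ℤ_[p]) (ϖ u Ω' : ℂ_[p]) (a : ℕ → ℂ_[p]) (k : ℕ → ℕ), ‖ϖ‖ < 1 → ‖u - 1‖ ≤ ‖ϖ‖ →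
      ‖Ω'‖ = 1 →
      (∀ t, t ≤ 2 →
        IntSeries.HasValueAt (IntSeries.monomialLine c₁ c₂ G) (u ^ t - 1) (a t * Ω' ^ k t)) →
      ‖a 0‖ < ‖ϖ‖ ^ 2 → ‖a 1‖ < ‖ϖ‖ ^ 2 → ‖a 2‖ = ‖ϖ‖ ^ 2 →
      (∀ m : ℕ, m ≤ 3 → ¬ IsUnit (PowerSeries.coeff m (PowerSeries.constantCoeff G))) →
      ¬ Summit.BirchSwinnertonDyer.BirchSwinnertonDyer.Theses.CycTangentCM.CycTangentBound := by
  intro A _ _ p _ hp hj hgood hord hirr K _ _ hK ψ hψ hL ι v vbar hv hvbar hne hι S hvS hvbarS hSram hSunr κ₁ κ₂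
    γ₁ γ₂ hpair hcyc hγ₂ Ω δ Ωp hΩ hΩp hδ G hG c₁ c₂ ϖ u Ω' a k hϖ hu hΩ' hval h0 h1 h2 hgap
  refine not_cycTangentBound_of_twoPointValues A p hp hj hgood hord hirr K hK ψ hψ hL ι v vbar hv hvbar hne
    hι S hvS hvbarS hSram hSunr κ₁ κ₂ γ₁ γ₂ hpair hcyc hγ₂ Ω δ Ωp hΩ hΩp hδ G hG c₁ c₂ ϖ u
    (fun t ↦ a t * Ω' ^ k t) hϖ hu hval ?_ ?_ ?_ hgap
  · rw [norm_mul_pow_eq_of_norm_eq_one hΩ']; exact h0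
  · rw [norm_mul_pow_eq_of_norm_eq_one hΩ']; exact h1
  · rw [norm_mul_pow_eq_of_norm_eq_one hΩ']; exact h2

end Summit.BirchSwinnertonDyer.BirchSwinnertonDyer.Theorems
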